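import Summits.Ventures.PercRepro.FaceDecideTen
import Summits.Ventures.PercRepro.FaceCodes
import Summits.Ventures.PercRepro.BigFaces

/-!
# Lemma B on every face from the checks of ANY list that covers the big faces

`faceMap_lemmaB_of_checks_list`: if a list `L` of code pairs contains `(encode u, encode v)` for
every face `(u, v)` with more than eight free edges, then one kernel check `facesCheckList m L`
gives Lemma B on every face of the graph — the general form of `faceMap_lemmaB_of_checks_ten`
(`L = bigFacesTen`); with the generated list `bigFaces k (k − 9)` of `BigFaces.lean` it is
**`faceMap_lemmaB_of_checks_big`**: Lemma B on every face of a `k`-edge graph from ONE kernel check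
of the faces with more than eight free edges.
-/

namespace PercRepro

namespace MultiGraph

/-- **Lemma B on every face from the checks of a list covering the big faces.** -/
theorem faceMap_lemmaB_of_checks_list {n k : ℕ} (G : MultiGraph (Fin n) (Fin k))
    (m : Fin 4 → Fin n) (L : List (ℕ × ℕ))
    (hL : ∀ u v : Config (Fin k), v ≤ u → 8 < Fintype.card (Face u v) → (encode u, encode v) ∈ L)
    (h : G.facesCheckList m L = true) (u v : Config (Fin k)) (hvu : v ≤ u) :
    crossCount cross4 (G.faceMap m u v) ≤ topBotCount (G.faceMap m u v) := by
  by_cases h8 : Fintype.card (Face u v) ≤ 8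
  · exact G.faceMap_lemmaB_of_card_le_eight m u v h8
  · have h0 := G.faceSlackZ_nonneg_of_facesCheckList m h (hL u v hvu (by omega)) (encode_lt u)
      (encode_lt v)
    rw [cfgOf_encode, cfgOf_encode] at h0
    exact G.faceMap_lemmaB_of_faceSlackZ_nonneg m hvu h0

/-- The twenty-one-face list of a ten-edge graph covers its big faces (so
`faceMap_lemmaB_of_checks_ten` is the instance `L = bigFacesTen` of the list theorem). -/
theorem bigFacesTen_covers (u v : Config (Fin 10)) (hvu : v ≤ u)
    (hbig : 8 < Fintype.card (Face u v)) : (encode u, encode v) ∈ bigFacesTen := by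
  have hone := atMostOne_of_card_face_gt (u := u) (v := v) (by simp; omega)
  by_cases hall : ∀ e, v e = false ∧ u e = true
  · obtain ⟨rfl, rfl⟩ := eq_top_bot_of_free hall
    rw [← cfgOf_two_pow_sub_one 10, ← cfgOf_zero (k := 10), encode_cfgOf _ (by norm_num),
      encode_cfgOf _ (by norm_num)]
    simp [bigFacesTen]
  · simp only [not_forall] at hall
    obtain ⟨e₀, hnot'⟩ := hall
    have hfree : ∀ e, e ≠ e₀ → v e = false ∧ u e = true := fun e he =>
      (hone e e₀ he).resolve_right hnot'
    have he₀ := e₀.isLt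
    rcases eq_codes_of_one_fixed hvu e₀ hfree hnot' with ⟨rfl, rfl⟩ | ⟨rfl, rfl⟩
    · rw [encode_cfgOf _ (by norm_num), encode_cfgOf _ (Nat.pow_lt_pow_right (by norm_num) he₀)]
      simp [bigFacesTen]
    · rw [encode_cfgOf _ (Nat.xor_lt_two_pow (by norm_num) (Nat.pow_lt_pow_right (by norm_num) he₀)),
        encode_cfgOf _ (by norm_num)]
      simp [bigFacesTen]

/-- A list check splits: the check of `L.take i` and the check of `L.drop i` give the check of
`L` (so a big list can be decided in several files, the row table rebuilt in each). -/
theorem facesCheckList_of_take_drop {n k : ℕ} (G : MultiGraph (Fin n) (Fin k)) (m : Fin 4 → Fin n)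
    (L : List (ℕ × ℕ)) (i : ℕ) (h₁ : G.facesCheckList m (L.take i) = true)
    (h₂ : G.facesCheckList m (L.drop i) = true) : G.facesCheckList m L = true := by
  unfold facesCheckList at *
  rw [withLitB_eq, decide_eq_true_iff] at *
  intro q hq
  rcases List.mem_append.mp (by rwa [List.take_append_drop] : q ∈ L.take i ++ L.drop i) with h | h
  · exact h₁ q h
  · exact h₂ q h

/-- **Lemma B on every face of a `k`-edge graph from the check of its big faces** (the faces with
more than eight free edges, listed by `bigFaces k (k − 9)`). -/
theorem faceMap_lemmaB_of_checks_big {n k : ℕ} (G : MultiGraph (Fin n) (Fin k))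
    (m : Fin 4 → Fin n) (h : G.facesCheckList m (bigFaces k (k - 9)) = true)
    (u v : Config (Fin k)) (hvu : v ≤ u) :
    crossCount cross4 (G.faceMap m u v) ≤ topBotCount (G.faceMap m u v) :=
  G.faceMap_lemmaB_of_checks_list m _ (fun u v hvu h8 => mem_bigFaces_of_card_face_gt u v hvu h8)
    h u v hvu

set_option maxRecDepth 10000 in
/-- The generated lists have the expected sizes: 21 faces at ten edges, 243 at eleven. -/
example : (bigFaces 10 1).length = 21 ∧ (bigFaces 11 2).length = 243 := by decide +kernel

end MultiGraph

end PercRepro
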